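import Summits.ResolutionOfSingularities.ResolutionOfSingularities.Theorems.PAlterationPicoverKernelHonesty
import Literature.AlgebraicGeometry.Resolution.BlowupsComposition
import Literature.AlgebraicGeometry.Resolution.BlowupsLocal
import HarnessLib

/-!
# Crux `AffineToGlobal` (stmt-ResolutionOfSingularities-15961), line `Sketch`: the stalk transfer

Route `ResolutionOfSingularities/SectionAscent`, crux `AffineToGlobal`, line `Sketch` (regular
yardsticks). Support file (`--supports stmt-ResolutionOfSingularities-15961`), registered stub
`stub_stalkTransfer` of the lead's skeleton.

The line builds a model `S` of a variety which is, locally on `S` (open pieces `ι : P ↪ S`), a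
blow-up `t : P → R` of a REGULAR Noetherian scheme `R`, and then runs the in-tree Temkin
localisation on `S`; Temkin's local hypothesis at the point `s = ι p₀` of `S` asks that every
blow-up `S'` of the local scheme `Spec 𝒪_{S,s}` admit a desingularization. This file discharges
it from "every blow-up of `R` admits a desingularization":

* every blow-up `b : X₁ → P` of `P` admits a desingularization, because `b ≫ t` is again a
  blow-up of the Noetherian scheme `R` (composition of blow-ups, Stacks 080B,
  `IsBlowup.exists_isBlowup_comp`);
* `P` is locally Noetherian (`t` is proper, in particular locally of finite type, over the
  Noetherian `R`), so Temkin's per-scheme converse (ii)⇒(iii) of Prop. 2.3.4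
  (`Picover.KernelHonesty.admitsDesingularization_of_isBlowup_stalk`) desingularizes every
  blow-up of `Spec 𝒪_{P,p₀}`;
* `ι` is an open immersion, so `ι.stalkMap p₀ : 𝒪_{S, ι p₀} → 𝒪_{P, p₀}` is an isomorphism and
  the blow-up `g : S' → Spec 𝒪_{S, ι p₀}` transports to a blow-up of `Spec 𝒪_{P,p₀}` with the
  same source (`IsBlowup.comp_iso`).

No new definitions; no statement item is restated. [cite: Temkin2008, Prop. 2.3.4]
[cite: StacksProject, Tag 080B]
-/

noncomputable section

set_option linter.dupNamespace false -- mandated namespace of this single-conjunct summit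

open CategoryTheory CategoryTheory.Limits AlgebraicGeometry TopologicalSpace IsLocalRing
open Literature.AlgebraicGeometry.Resolution

namespace Summit.ResolutionOfSingularities.ResolutionOfSingularities.Theorems.AffineToGlobal.StalkTransfer

/-- **Blow-ups of a blow-up of a Noetherian scheme admit desingularizations if the blow-ups of
the base do.** If every blow-up of the Noetherian scheme `R` admits a desingularization and
`t : P → R` is a blow-up, then every blow-up `b : X₁ → P` of `P` admits a desingularization:
`b ≫ t` is a blow-up of `R` (Stacks, Tag 080B). [cite: StacksProject, Tag 080B] -/
theorem admitsDesingularization_of_isBlowup_of_isBlowup (R : Scheme.{0}) [IsNoetherian R]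
    (hR : ∀ (M : Scheme.{0}) (π : M ⟶ R) (J : R.IdealSheafData), IsBlowup π J →
      Scheme.AdmitsDesingularization M)
    {P : Scheme.{0}} {t : P ⟶ R} {Q : R.IdealSheafData} (ht : IsBlowup t Q)
    (X₁ : Scheme.{0}) (b : X₁ ⟶ P) (J₁ : P.IdealSheafData) (hb : IsBlowup b J₁) :
    Scheme.AdmitsDesingularization X₁ := by
  obtain ⟨Q', hQ', -⟩ := ht.exists_isBlowup_comp hb
  exact hR X₁ (b ≫ t) Q' hQ'

/-- **Stalk transfer** (stub `stub_stalkTransfer` of line `Sketch`). If every blow-up of the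
Noetherian scheme `R` admits a desingularization, `t : P → R` is a blow-up and `ι : P ↪ S` an
open immersion, then every blow-up of `Spec 𝒪_{S, ι p₀}` admits a desingularization: the
blow-ups of `P` admit desingularizations (`admitsDesingularization_of_isBlowup_of_isBlowup`),
`P` is locally Noetherian (`t` is proper over the Noetherian `R`), so Temkin 2008, Prop. 2.3.4
(ii)⇒(iii) per scheme (`Picover.KernelHonesty.admitsDesingularization_of_isBlowup_stalk`)
applies to `P` at `p₀`, and `Spec 𝒪_{S, ι p₀} ≅ Spec 𝒪_{P, p₀}` along the stalk map of the open
immersion `ι` (`IsBlowup.comp_iso`). [cite: Temkin2008, Prop. 2.3.4] -/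
theorem stub_stalkTransfer (R : Scheme.{0}) [IsNoetherian R]
    (hR : ∀ (M : Scheme.{0}) (π : M ⟶ R) (J : R.IdealSheafData), IsBlowup π J →
      Scheme.AdmitsDesingularization M)
    (P S : Scheme.{0}) (t : P ⟶ R) (Q : R.IdealSheafData) (ht : IsBlowup t Q)
    (ι : P ⟶ S) [IsOpenImmersion ι] (p₀ : P)
    (S' : Scheme.{0}) (g : S' ⟶ Spec (S.presheaf.stalk (ι p₀)))
    (I : (Spec (S.presheaf.stalk (ι p₀))).IdealSheafData) (hg : IsBlowup g I) :
    Scheme.AdmitsDesingularization S' := by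
  -- `P` is locally Noetherian: `t` is proper over the Noetherian scheme `R`
  haveI : IsProper t := ht.isProper
  haveI : IsLocallyNoetherian P := LocallyOfFiniteType.isLocallyNoetherian t
  -- `Spec 𝒪_{S, ι p₀} ≅ Spec 𝒪_{P, p₀}` along the (invertible) stalk map of `ι`
  let e : Spec (S.presheaf.stalk (ι p₀)) ≅ Spec (P.presheaf.stalk p₀) :=
    (asIso (Spec.map (ι.stalkMap p₀))).symm
  have hg' : IsBlowup (g ≫ e.hom) (I.comap e.inv) := hg.comp_iso e
  exact Picover.KernelHonesty.admitsDesingularization_of_isBlowup_stalk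
    (admitsDesingularization_of_isBlowup_of_isBlowup R hR ht) p₀ hg'

end Summit.ResolutionOfSingularities.ResolutionOfSingularities.Theorems.AffineToGlobal.StalkTransfer

end
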